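import Mathlib
import Literature.NumberTheory.LFunctions.Zhang2022.Section7bStatements
import Literature.NumberTheory.LFunctions.Zhang2022.Section7I1Kernel
import HarnessLib

/-!
# Zhang (2022) §7, proof of Proposition 7.1: "integration term-by-term" — the node `Z22:§7.u022`

Topic `Literature/NumberTheory/LFunctions/Zhang2022` (Landau–Siegel adjudication tree;
verdict-neutral). Y. Zhang, *Discrete mean estimates and the Landau–Siegel zero*,
arXiv:2211.02515v1 (2022) [Zhang2022LandauSiegel], §7 p. 35, tex L1920–L1924 (DAG nodes
`Z22:§7.u021`, `Z22:§7.u022`, inside the proof node of Proposition 7.1, cone leaf C18):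

> Assume `ψ (mod p) ∈ Ψ`. By (2.4), in the integral `I₁(ψ)`, the factor `Z(s,ψ)⁻¹` can be replaced by
> `τ(ψ̄)p^{s−1}ϑ*(1−s)`, and then … the segment `𝒥(1)` can be replaced by the line `σ = 3/2`, with
> negligible errors. Thus, integration term-by-term gives
> `I₁(ψ) = (τ(ψ̄)/p) Σ_m Σ_n (κ∗a₁)(m)a₂(n)ψ(m)ψ̄(n) n⁻¹ Δ₁(m/(pn)) + O(ε)`.

The typed nodes are `Section7bStatements.Step7u021 c′` (`I₁(ψ) = I1line + O(ε)`) and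
`Section7bStatements.Step7u022 c′` (`I₁(ψ) = I1termwise + O(ε)`), with the objects `I1line` (the line
integral on `σ = 3/2`) and `I1termwise` (the double series with `Δ₁` of (5.6), `Iface.Delta1W` = the
tree's `Lemma53.Delta1_56`). This file kernel-checks the step "integration term-by-term" itself
(analytic inputs — the kernel bound on the line, the Gaussian majorant, the absolute convergence of
the `m`-series and the exponent bookkeeping — in `Section7I1Kernel.lean`):

* `Section7I1Termwise.I1line_eq_I1termwise` — for `log D > 0` and bounded `𝐚₁` (any `𝐚₂`):
  `I1line = I1termwise` EXACTLY. On `σ = 3/2`, `τ(ψ̄)p^{s−1}·m^{−s}·n^{−(1−s)} = (τ(ψ̄)/p)n⁻¹(m/(pn))^{−s}`,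
  and the interchange of `∫_ℝ` with `Σ_m Σ_n` is Fubini–Tonelli
  (`MeasureTheory.integral_tsum_of_summable_integral_norm`): `Σ_m |(κ∗a₁)(m)|m^{−3/2} < ∞`
  (`κ = n^{−β₁} ∗ n^{−β₂} ∗ n^{−β₃} ∗ μ` has an absolutely convergent L-series on `σ > 1`, Mathlib's
  `LSeriesSummable.convolution`), the `n`-sum is finite, and on the line
  `|ϑ*(1−s)| ≤ K(1+|t|)^N` (`x^{−s}ϑ*(1−s) = Γ(s)(2πix)^{−s}`, tree `Lemma53.cpow_neg_mul_varthetaStar_eq`,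
  with the tree's Stirling-type bound `exists_norm_Gamma_vertical_le`) against the Gaussian
  `|ω(3/2+it)| = (√π/𝓛₂)e^{(1−(t−2πt₀)²)/(4𝓛₂²)}` (`Lemma53.norm_omega_vertical`);
* `Section7I1Termwise.step7u022_of_step7u021 : Step7u021 c′ → Step7u022 c′` — the node `§7.u022`
  from `§7.u021` (`‖I₁(ψ) − I1termwise‖ = ‖I₁(ψ) − I1line‖`); with the tree's
  `Section7bStatements.step7u023_of_step7u022` it continues to `§7.u023`.

No new definitions, no new named facts; nothing here bears on Theorems 1–2 of the source or on the
cell's verdict on (8.24).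

## References

* Y. Zhang, arXiv:2211.02515v1 (2022), §7 p. 35, tex L1920–L1924; (5.5)–(5.6) p. 26.
  [cite: Zhang2022LandauSiegel, §7 p.35 tex L1921]
* E. C. Titchmarsh, *The Theory of the Riemann Zeta-Function*, 2nd ed., OUP 1986, §2.15
  (Cahen–Mellin), §4.12 (Stirling). [cite: Titchmarsh1986, §2.15]
-/

noncomputable section

open Complex Real MeasureTheory Filter Topology Set
open scoped LSeries.notation

namespace Literature.NumberTheory.LFunctions.Zhang2022.Section7I1Termwise

open Literature.NumberTheory.LFunctions.Zhang2022.Section7bStatements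
open Literature.NumberTheory.LFunctions.Zhang2022.Skeleton
open Literature.NumberTheory.LFunctions.Zhang2022.Section7I1Kernel

/-! ## §1. `I1line = I1termwise` -/

/-- **"Integration term-by-term"** (tex L1921): for `log D > 0` (so `𝓛₂ > 0`) and bounded
`𝐚₁` (any `𝐚₂`), the line integral `I1line` EQUALS the double series `I1termwise`
(`(τ(ψ̄)/p)Σ_mΣ_n (κ∗a₁)(m)a₂(n)ψ(m)ψ̄(n)n⁻¹Δ₁(m/(pn))`, `Δ₁` of (5.6)): Fubini–Tonelli on
`σ = 3/2` with the exponent bookkeeping `cpow_bookkeeping`.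
[cite: Zhang2022LandauSiegel, §7 p.35 tex L1921] -/
theorem I1line_eq_I1termwise (c' : ℝ) {D : ℕ} (hD : 0 < ell D) (x : Chr D) {B : ℝ}
    {a₁ : ℕ → ℂ} (a₂ : ℕ → ℂ) (ha₁ : ∀ n, ‖a₁ n‖ ≤ B) :
    I1line c' x a₁ a₂ = I1termwise c' x a₁ a₂ := by
  classical
  have hL : 0 < ell2 D := by unfold ell2; positivity
  have hp : 0 < x.p := x.prime.pos
  have hp' : (x.p : ℂ) ≠ 0 := Nat.cast_ne_zero.mpr hp.ne'
  have hB : 0 ≤ B := (norm_nonneg _).trans (ha₁ 0)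
  obtain ⟨K, N, hK, hN, hΦ⟩ := exists_kernel_bound
  -- abbreviations (opaque names with defining equations)
  obtain ⟨b, hb⟩ : ∃ b : ℕ → ℂ, b = fun m : ℕ => kappaConv c' D a₁ m * x.ψ (m : ZMod x.p) := ⟨_, rfl⟩
  obtain ⟨V, hV⟩ : ∃ V : ℝ → ℂ, V = fun t : ℝ => GammaFactor.varthetaStarOneSub ((3 / 2 : ℂ) + t * I) :=
    ⟨_, rfl⟩
  obtain ⟨W, hW⟩ : ∃ W : ℝ → ℂ, W = fun t : ℝ => omegaW D ((3 / 2 : ℂ) + t * I) := ⟨_, rfl⟩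
  obtain ⟨τ, hτ⟩ : ∃ τ : ℂ, τ = GammaFactor.tau x.ψ⁻¹ := ⟨_, rfl⟩
  obtain ⟨Nn, hNn⟩ : ∃ Nn : ℕ, Nn = Nsupp D := ⟨_, rfl⟩
  -- the summands `H m n t`
  obtain ⟨H, hH⟩ : ∃ H : ℕ → ℕ → ℝ → ℂ, H = fun (m n : ℕ) (t : ℝ) =>
      LSeries.term b ((3 / 2 : ℂ) + t * I) m *
        (a₂ n * x.ψ⁻¹ (n : ZMod x.p) * (n : ℂ) ^ (-(1 - ((3 / 2 : ℂ) + t * I)))) *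
        (τ * (x.p : ℂ) ^ (((3 / 2 : ℂ) + t * I) - 1) * V t * W t) := ⟨_, rfl⟩
  -- §A. the integrand of `I1line` is `Σ'_m Σ_n H m n t`
  have hintegrand : ∀ t : ℝ,
      τ * (x.p : ℂ) ^ (((3 / 2 : ℂ) + t * I) - 1) *
          GammaFactor.varthetaStarOneSub ((3 / 2 : ℂ) + t * I) *
          LSeries b ((3 / 2 : ℂ) + t * I) *
          ApolyBar x a₂ (1 - ((3 / 2 : ℂ) + t * I)) * omegaW D ((3 / 2 : ℂ) + t * I) =
        ∑' m : ℕ, ∑ n ∈ Finset.range Nn, H m n t := by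
    intro t
    have hA : ApolyBar x a₂ (1 - ((3 / 2 : ℂ) + t * I)) =
        ∑ n ∈ Finset.range Nn, a₂ n * x.ψ⁻¹ (n : ZMod x.p) *
          (n : ℂ) ^ (-(1 - ((3 / 2 : ℂ) + t * I))) := by rw [hNn]; rfl
    have hVt : GammaFactor.varthetaStarOneSub ((3 / 2 : ℂ) + t * I) = V t := by rw [hV]
    have hWt : omegaW D ((3 / 2 : ℂ) + t * I) = W t := by rw [hW]
    rw [hA, hVt, hWt, LSeries]
    calc τ * (x.p : ℂ) ^ (((3 / 2 : ℂ) + t * I) - 1) * V t *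
          (∑' m : ℕ, LSeries.term b ((3 / 2 : ℂ) + t * I) m) *
          (∑ n ∈ Finset.range Nn, a₂ n * x.ψ⁻¹ (n : ZMod x.p) *
            (n : ℂ) ^ (-(1 - ((3 / 2 : ℂ) + t * I)))) * W t
        = (∑' m : ℕ, LSeries.term b ((3 / 2 : ℂ) + t * I) m) *
            ((∑ n ∈ Finset.range Nn, a₂ n * x.ψ⁻¹ (n : ZMod x.p) *
              (n : ℂ) ^ (-(1 - ((3 / 2 : ℂ) + t * I)))) *
              (τ * (x.p : ℂ) ^ (((3 / 2 : ℂ) + t * I) - 1) * V t * W t)) := by ring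
      _ = ∑' m : ℕ, LSeries.term b ((3 / 2 : ℂ) + t * I) m *
            ((∑ n ∈ Finset.range Nn, a₂ n * x.ψ⁻¹ (n : ZMod x.p) *
              (n : ℂ) ^ (-(1 - ((3 / 2 : ℂ) + t * I)))) *
              (τ * (x.p : ℂ) ^ (((3 / 2 : ℂ) + t * I) - 1) * V t * W t)) :=
          tsum_mul_right.symm
      _ = ∑' m : ℕ, ∑ n ∈ Finset.range Nn, H m n t := by
          refine tsum_congr fun m => ?_
          rw [Finset.sum_mul, Finset.mul_sum, hH]
          refine Finset.sum_congr rfl fun n _ => ?_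
          ring
  -- §B. norms of the factors
  have hterm : ∀ m : ℕ, ∀ t : ℝ,
      ‖LSeries.term b ((3 / 2 : ℂ) + t * I) m‖ = ‖LSeries.term b (3 / 2 : ℂ) m‖ := by
    intro m t
    rw [LSeries.norm_term_eq, LSeries.norm_term_eq]
    simp
  have hncpow : ∀ n : ℕ, ∀ t : ℝ,
      ‖(n : ℂ) ^ (-(1 - ((3 / 2 : ℂ) + t * I)))‖ = (n : ℝ) ^ (1 / 2 : ℝ) := by
    intro n t
    rcases Nat.eq_zero_or_pos n with rfl | hn
    · rw [Nat.cast_zero, Complex.zero_cpow (neg_one_sub_ne_zero t), norm_zero, Nat.cast_zero,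
        Real.zero_rpow (by norm_num)]
    · rw [Complex.norm_natCast_cpow_of_pos hn]
      congr 1
      simp
      norm_num
  have hpcpow : ∀ t : ℝ, ‖(x.p : ℂ) ^ (((3 / 2 : ℂ) + t * I) - 1)‖ = (x.p : ℝ) ^ (1 / 2 : ℝ) := by
    intro t
    rw [Complex.norm_natCast_cpow_of_pos hp]
    congr 1
    simp
    norm_num
  have hVle : ∀ t : ℝ, ‖V t‖ ≤ K * (1 + |t|) ^ N := by
    intro t
    have h := hΦ 1 one_pos t
    rw [Complex.ofReal_one, Complex.one_cpow, one_mul, Real.one_rpow, mul_one] at h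
    rw [hV]
    exact h
  obtain ⟨E, hE⟩ : ∃ E : ℝ, E = Real.sqrt π / ell2 D * Real.exp (1 / (4 * ell2 D ^ 2)) := ⟨_, rfl⟩
  have hE0 : 0 ≤ E := by rw [hE]; positivity
  have hWle : ∀ t : ℝ, ‖W t‖ ≤ E * Real.exp (-((t - 2 * π * t0 D) ^ 2) / (4 * ell2 D ^ 2)) := by
    intro t; rw [hW, hE]; exact norm_omega_line_le hL t
  -- the integrable majorant `g`
  obtain ⟨g, hg⟩ : ∃ g : ℝ → ℝ, g = fun t : ℝ =>
      (1 + |t|) ^ N * Real.exp (-((t - 2 * π * t0 D) ^ 2) / (4 * ell2 D ^ 2)) := ⟨_, rfl⟩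
  have hgi : Integrable g := by rw [hg]; exact integrable_majorant hL hN _
  have hg0 : ∀ t, 0 ≤ g t := fun t => by rw [hg]; positivity
  -- per-(m,n) constants
  obtain ⟨cst, hcst⟩ : ∃ cst : ℕ → ℕ → ℝ, cst = fun (m n : ℕ) =>
      ‖LSeries.term b (3 / 2 : ℂ) m‖ *
        (‖a₂ n‖ * ‖x.ψ⁻¹ (n : ZMod x.p)‖ * (n : ℝ) ^ (1 / 2 : ℝ)) *
        (‖τ‖ * (x.p : ℝ) ^ (1 / 2 : ℝ) * K * E) := ⟨_, rfl⟩
  have hcst' : ∀ m n, cst m n = ‖LSeries.term b (3 / 2 : ℂ) m‖ *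
      (‖a₂ n‖ * ‖x.ψ⁻¹ (n : ZMod x.p)‖ * (n : ℝ) ^ (1 / 2 : ℝ)) *
      (‖τ‖ * (x.p : ℝ) ^ (1 / 2 : ℝ) * K * E) := fun m n => by rw [hcst]
  have hg' : ∀ t, g t = (1 + |t|) ^ N * Real.exp (-((t - 2 * π * t0 D) ^ 2) / (4 * ell2 D ^ 2)) :=
    fun t => by rw [hg]
  have hcst0 : ∀ m n, 0 ≤ cst m n := fun m n => by rw [hcst']; positivity
  have hHle : ∀ m n t, ‖H m n t‖ ≤ cst m n * g t := by
    intro m n t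
    have h1 := hVle t
    have h2 := hWle t
    have hW0 : 0 ≤ ‖W t‖ := norm_nonneg _
    have hA0 : 0 ≤ ‖LSeries.term b (3 / 2 : ℂ) m‖ *
        (‖a₂ n‖ * ‖x.ψ⁻¹ (n : ZMod x.p)‖ * (n : ℝ) ^ (1 / 2 : ℝ)) *
        (‖τ‖ * (x.p : ℝ) ^ (1 / 2 : ℝ)) := by positivity
    have e1 : ‖H m n t‖ = ‖LSeries.term b (3 / 2 : ℂ) m‖ *
        (‖a₂ n‖ * ‖x.ψ⁻¹ (n : ZMod x.p)‖ * (n : ℝ) ^ (1 / 2 : ℝ)) *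
        (‖τ‖ * (x.p : ℝ) ^ (1 / 2 : ℝ)) * (‖V t‖ * ‖W t‖) := by
      rw [hH]
      simp only [norm_mul]
      rw [hterm m t, hncpow n t, hpcpow t]
      ring
    rw [e1, hcst', hg']
    calc ‖LSeries.term b (3 / 2 : ℂ) m‖ *
          (‖a₂ n‖ * ‖x.ψ⁻¹ (n : ZMod x.p)‖ * (n : ℝ) ^ (1 / 2 : ℝ)) *
          (‖τ‖ * (x.p : ℝ) ^ (1 / 2 : ℝ)) * (‖V t‖ * ‖W t‖)
        ≤ ‖LSeries.term b (3 / 2 : ℂ) m‖ *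
            (‖a₂ n‖ * ‖x.ψ⁻¹ (n : ZMod x.p)‖ * (n : ℝ) ^ (1 / 2 : ℝ)) *
            (‖τ‖ * (x.p : ℝ) ^ (1 / 2 : ℝ)) *
            ((K * (1 + |t|) ^ N) * (E * Real.exp (-((t - 2 * π * t0 D) ^ 2) / (4 * ell2 D ^ 2)))) :=
          mul_le_mul_of_nonneg_left (mul_le_mul h1 h2 hW0 (by positivity)) hA0
      _ = _ := by ring
  -- continuity and integrability of each `H m n`
  have hHint : ∀ m n, Integrable (H m n) := by
    intro m n
    refine (hgi.const_mul (cst m n)).mono' ?_ (Eventually.of_forall (hHle m n))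
    rcases Nat.eq_zero_or_pos m with rfl | hm
    · have : H 0 n = fun _ => 0 := by funext t; rw [hH]; simp [LSeries.term_zero]
      rw [this]; exact aestronglyMeasurable_const
    rcases Nat.eq_zero_or_pos n with rfl | hn
    · have : H m 0 = fun _ => 0 := by
        funext t
        rw [hH]
        beta_reduce
        simp only [Nat.cast_zero]
        rw [Complex.zero_cpow (neg_one_sub_ne_zero t)]
        simp
      rw [this]; exact aestronglyMeasurable_const
    -- `m, n ≥ 1`: continuous
    have hmc : Continuous fun t : ℝ => LSeries.term b ((3 / 2 : ℂ) + t * I) m := by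
      simp_rw [LSeries.term_of_ne_zero hm.ne']
      refine continuous_const.div ?_ fun t => ?_
      · exact continuous_iff_continuousAt.2 fun t =>
          (continuousAt_const_cpow (Nat.cast_ne_zero.mpr hm.ne')).comp
            (by fun_prop : Continuous fun t : ℝ => (3 / 2 : ℂ) + t * I).continuousAt
      · exact (cpow_ne_zero_iff_of_exponent_ne_zero (three_halves_add_ne_zero t)).mpr
            (Nat.cast_ne_zero.mpr hm.ne')
    have hnc : Continuous fun t : ℝ => (n : ℂ) ^ (-(1 - ((3 / 2 : ℂ) + t * I))) :=
      continuous_iff_continuousAt.2 fun t =>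
        (continuousAt_const_cpow (Nat.cast_ne_zero.mpr hn.ne')).comp
          (by fun_prop : Continuous fun t : ℝ => -(1 - ((3 / 2 : ℂ) + t * I))).continuousAt
    have hpc : Continuous fun t : ℝ => (x.p : ℂ) ^ (((3 / 2 : ℂ) + t * I) - 1) :=
      continuous_iff_continuousAt.2 fun t =>
        (continuousAt_const_cpow hp').comp
          (by fun_prop : Continuous fun t : ℝ => ((3 / 2 : ℂ) + t * I) - 1).continuousAt
    have hVc : Continuous V := by rw [hV]; exact continuous_varthetaStar
    have hWc : Continuous W := by rw [hW]; exact continuous_omega_line D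
    have hc : Continuous (H m n) := by
      rw [hH]
      exact (hmc.mul ((continuous_const.mul hnc))).mul
        (((continuous_const.mul hpc).mul hVc).mul hWc)
    exact hc.aestronglyMeasurable
  -- summability in `m` of `∫ ‖Σ_n H m n‖`
  have hsum_b : Summable fun m : ℕ => ‖LSeries.term b (3 / 2 : ℂ) m‖ := by
    have h := LSeriesSummable_coeff c' x ha₁ (s := (3 / 2 : ℂ)) (by norm_num)
    rw [hb]; exact h.norm
  obtain ⟨G, hG⟩ : ∃ G : ℝ, G = ∫ t, g t := ⟨_, rfl⟩
  have hG0 : 0 ≤ G := by rw [hG]; exact integral_nonneg hg0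
  obtain ⟨Cn, hCn⟩ : ∃ Cn : ℝ, Cn = ∑ n ∈ Finset.range Nn,
      (‖a₂ n‖ * ‖x.ψ⁻¹ (n : ZMod x.p)‖ * (n : ℝ) ^ (1 / 2 : ℝ)) *
        (‖τ‖ * (x.p : ℝ) ^ (1 / 2 : ℝ) * K * E) := ⟨_, rfl⟩
  have hCn0 : 0 ≤ Cn := by rw [hCn]; exact Finset.sum_nonneg fun n _ => by positivity
  have hnorm_int : ∀ m, ∫ t, ‖∑ n ∈ Finset.range Nn, H m n t‖ ≤
      ‖LSeries.term b (3 / 2 : ℂ) m‖ * Cn * G := by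
    intro m
    have hmaj : Integrable fun t => (‖LSeries.term b (3 / 2 : ℂ) m‖ * Cn) * g t :=
      hgi.const_mul _
    calc ∫ t, ‖∑ n ∈ Finset.range Nn, H m n t‖
        ≤ ∫ t, (‖LSeries.term b (3 / 2 : ℂ) m‖ * Cn) * g t := by
          refine integral_mono_of_nonneg (Eventually.of_forall fun t => norm_nonneg _) hmaj
            (Eventually.of_forall fun t => ?_)
          calc ‖∑ n ∈ Finset.range Nn, H m n t‖ ≤ ∑ n ∈ Finset.range Nn, ‖H m n t‖ :=
                norm_sum_le _ _
            _ ≤ ∑ n ∈ Finset.range Nn, cst m n * g t := Finset.sum_le_sum fun n _ => hHle m n t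
            _ = (‖LSeries.term b (3 / 2 : ℂ) m‖ * Cn) * g t := by
                rw [hCn, Finset.mul_sum, Finset.sum_mul]
                refine Finset.sum_congr rfl fun n _ => ?_
                rw [hcst']
                ring
      _ = ‖LSeries.term b (3 / 2 : ℂ) m‖ * Cn * G := by
          rw [integral_const_mul, hG]
  have hsumm : Summable fun m => ∫ t, ‖∑ n ∈ Finset.range Nn, H m n t‖ := by
    refine Summable.of_nonneg_of_le (fun m => integral_nonneg fun t => norm_nonneg _) hnorm_int ?_
    exact (hsum_b.mul_right Cn).mul_right G
  have hFint : ∀ m, Integrable fun t => ∑ n ∈ Finset.range Nn, H m n t :=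
    fun m => integrable_finsetSum _ fun n _ => hHint m n
  -- §C. Fubini: `∫ Σ'_m Σ_n = Σ'_m Σ_n ∫`
  have hFubini : ∫ t, ∑' m : ℕ, ∑ n ∈ Finset.range Nn, H m n t =
      ∑' m : ℕ, ∑ n ∈ Finset.range Nn, ∫ t, H m n t := by
    rw [← integral_tsum_of_summable_integral_norm hFint hsumm]
    refine tsum_congr fun m => ?_
    exact integral_finsetSum _ fun n _ => hHint m n
  -- §D. the individual integrals
  have hΔ : ∀ m n : ℕ, 0 < m → 0 < n →
      1 / (2 * π) * ∫ t, H m n t =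
        τ / (x.p : ℂ) *
          (kappaConv c' D a₁ m * a₂ n * x.ψ (m : ZMod x.p) * x.ψ⁻¹ (n : ZMod x.p) / (n : ℂ) *
            Iface.Delta1W D ((m : ℝ) / ((x.p : ℝ) * n))) := by
    intro m n hm hn
    have hy : (0 : ℝ) < (m : ℝ) / ((x.p : ℝ) * n) := by positivity
    have hpt : ∀ t : ℝ, H m n t =
        (τ / (x.p : ℂ) * (kappaConv c' D a₁ m * a₂ n * x.ψ (m : ZMod x.p) *
          x.ψ⁻¹ (n : ZMod x.p) / (n : ℂ))) *
          (((((m : ℝ) / ((x.p : ℝ) * n)) : ℝ) : ℂ) ^ (-((3 / 2 : ℂ) + t * I)) * V t * W t) := by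
      intro t
      have key := cpow_bookkeeping hp hm hn ((3 / 2 : ℂ) + t * I)
      rw [hH]
      simp only [hb, LSeries.term_of_ne_zero hm.ne']
      calc kappaConv c' D a₁ m * x.ψ (m : ZMod x.p) / (m : ℂ) ^ ((3 / 2 : ℂ) + t * I) *
            (a₂ n * x.ψ⁻¹ (n : ZMod x.p) * (n : ℂ) ^ (-(1 - ((3 / 2 : ℂ) + t * I)))) *
            (τ * (x.p : ℂ) ^ (((3 / 2 : ℂ) + t * I) - 1) * V t * W t)
          = (kappaConv c' D a₁ m * x.ψ (m : ZMod x.p) * a₂ n * x.ψ⁻¹ (n : ZMod x.p) * τ *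
              V t * W t) *
              ((x.p : ℂ) ^ (((3 / 2 : ℂ) + t * I) - 1) * (n : ℂ) ^ (-(1 - ((3 / 2 : ℂ) + t * I))) /
                (m : ℂ) ^ ((3 / 2 : ℂ) + t * I)) := by ring
        _ = (kappaConv c' D a₁ m * x.ψ (m : ZMod x.p) * a₂ n * x.ψ⁻¹ (n : ZMod x.p) * τ *
              V t * W t) *
              (((((m : ℝ) / ((x.p : ℝ) * n)) : ℝ) : ℂ) ^ (-((3 / 2 : ℂ) + t * I)) /
                ((x.p : ℂ) * n)) := by rw [key]
        _ = _ := by ring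
    have hΔ1 : Iface.Delta1W D ((m : ℝ) / ((x.p : ℝ) * n)) = 1 / (2 * π) *
        ∫ t : ℝ, ((((m : ℝ) / ((x.p : ℝ) * n)) : ℝ) : ℂ) ^ (-((3 / 2 : ℂ) + t * I)) * V t * W t := by
      rw [hV, hW]; rfl
    simp_rw [hpt]
    rw [integral_const_mul, hΔ1]
    ring
  have hH0n : ∀ m : ℕ, ∀ t : ℝ, H m 0 t = 0 := by
    intro m t
    rw [hH]
    beta_reduce
    simp only [Nat.cast_zero]
    rw [Complex.zero_cpow (neg_one_sub_ne_zero t)]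
    simp
  have hH0m : ∀ n : ℕ, ∀ t : ℝ, H 0 n t = 0 := by
    intro n t; rw [hH]; simp [LSeries.term_zero]
  -- §E. assemble
  have hlhs : I1line c' x a₁ a₂ =
      1 / (2 * π) * ∫ t : ℝ, ∑' m : ℕ, ∑ n ∈ Finset.range Nn, H m n t := by
    rw [I1line, ← hτ, ← hb]
    congr 1
    refine integral_congr_ae (Eventually.of_forall fun t => ?_)
    exact hintegrand t
  rw [hlhs, hFubini, I1termwise, ← hτ, ← hNn, ← tsum_mul_left, ← tsum_mul_left]
  refine tsum_congr fun m => ?_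
  rw [Finset.mul_sum, Finset.mul_sum]
  rcases Nat.eq_zero_or_pos m with rfl | hm
  · -- `m = 0`: both sides vanish termwise
    have h1 : ∀ n ∈ Finset.range Nn, 1 / (2 * (π : ℂ)) * ∫ t : ℝ, H 0 n t = 0 := by
      intro n _; simp_rw [hH0m]; simp
    have h2 : ∀ n ∈ Finset.Ico 1 Nn, τ / (x.p : ℂ) *
        (kappaConv c' D a₁ 0 * a₂ n * x.ψ ((0 : ℕ) : ZMod x.p) * x.ψ⁻¹ (n : ZMod x.p) / (n : ℂ) *
          Iface.Delta1W D (((0 : ℕ) : ℝ) / ((x.p : ℝ) * n))) = 0 := by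
      intro n _
      rw [kappaConv, LSeries.convolution_map_zero]
      simp
    rw [Finset.sum_eq_zero h1, Finset.sum_eq_zero h2]
  · -- `m ≥ 1`: the `n = 0` term vanishes, the others are `hΔ`
    rcases Nat.eq_zero_or_pos Nn with hN0 | hN0
    · rw [hN0]; simp
    rw [Finset.range_eq_Ico, Finset.sum_eq_sum_Ico_succ_bot hN0]
    have h0 : 1 / (2 * (π : ℂ)) * ∫ t : ℝ, H m 0 t = 0 := by simp_rw [hH0n]; simp
    rw [h0, zero_add]
    refine Finset.sum_congr rfl fun n hn => ?_
    have hn1 : 0 < n := (Finset.mem_Ico.mp hn).1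
    rw [hΔ m n hm hn1]

/-! ## §2. The node `§7.u022` from `§7.u021` -/

/-- **`Z22:§7.u022` from `Z22:§7.u021`** ("Thus, integration term-by-term gives …"): once
`I₁(ψ) = I1line + O(ε)` (node `§7.u021`), the term-by-term identity `I1line = I1termwise`
gives `I₁(ψ) = I1termwise + O(ε)` with the same `c, C` (for `D ≥ 2`, so that `log D > 0`).
[cite: Zhang2022LandauSiegel, §7 p.35 tex L1921] -/
theorem step7u022_of_step7u021 (c' : ℝ) (h : Step7u021 c') : Step7u022 c' := by
  intro B
  obtain ⟨c, hc, C, D₀, hD₀⟩ := h B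
  refine ⟨c, hc, C, max D₀ 2, fun D _ χ hD hq hp hA a₁ a₂ ha₁ ha₂ x => ?_⟩
  have hD2 : 2 ≤ D := le_trans (le_max_right _ _) hD
  have hℓ : 0 < ell D := by
    unfold ell
    exact Real.log_pos (by exact_mod_cast (by omega : 1 < D))
  rw [← I1line_eq_I1termwise c' hℓ x a₂ ha₁.1]
  exact hD₀ D χ (le_trans (le_max_left _ _) hD) hq hp hA a₁ a₂ ha₁ ha₂ x

end Literature.NumberTheory.LFunctions.Zhang2022.Section7I1Termwise
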